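import Summits.BirchSwinnertonDyer.BirchSwinnertonDyer.Theorems.GenusKolyvaginAtTwoGenusPrimitiveSupplyAtTwoTwistLemma211TwoTorsion
import Summits.BirchSwinnertonDyer.BirchSwinnertonDyer.Theorems.GenusKolyvaginAtTwoGenusPrimitiveSupplyAtTwoTwistSelmerTransferDown
import Summits.BirchSwinnertonDyer.Rank1Residual.X11b.KummerRelaxedStructures
import HarnessLib

/-!
# Route `GenusKolyvaginAtTwo`, crux #2 `GenusPrimitiveSupplyAtTwo` (stmt-BirchSwinnertonDyer-22136):
# MAZUR–RUBIN LEMMA 2.11 for the twist pair `(E, E^{(d)})` — at a good odd place RAMIFIED in `K(√d)` the local Kummer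
# conditions are TRANSVERSE — together with Lemma 2.10 (i), for ONE intertwining identification `E^{(d)}[2] ≅ E[2]`

Width seat `bsd-line-gk2-p5` g8 (cell `bsd-f1-sign2`, SUPPLY lineage), ninth file of the series (crux workfile
`Lines/genus-supply-mr-instantiation.md`). THEOREMS ONLY (no definition, no named fact, no `sorry`); helper
`--supports stmt-BirchSwinnertonDyer-22136`; no item is closed; BSD is not proved by any of this.

WHAT. `exists_intertwining_hsplit_and_transverse`: for `W/K` elliptic over a number field, `d ≠ 0`, `Wd = C • W^{(d)}` elliptic, there
are mutually inverse `Γ_K`-intertwining maps `φ : Wd[2] ⇄ W[2] : φ'` (the untwisting, Mazur–Rubin Remark 2.4) such that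
(i) at every `K`-field where `d` is a square the local `2`-Kummer conditions AGREE along `H¹(φ∣)` (Lemma 2.10 (i); the hypothesis
`hsplit` of `natCard_selmerGroup_twist_mul_two_eq_of_local`, p620693), and (ii) at every finite place `v ∤ 2` of good reduction for `W`
that is RAMIFIED in `K(√d)` (`ι(√d) ∉ K_v^{nr}`) they are TRANSVERSE:
`(Wd.kummerLocalConditionAt 2 K_v).map H¹(φ∣) ⊓ W.kummerLocalConditionAt 2 K_v = ⊥` — MAZUR–RUBIN LEMMA 2.11, the hypothesis
`htr` of p620693. With this file the DOWN half of `MazurRubin2010.cor34i_singleton_rat` that the line's SUPPLY uses is a kernel theorem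
modulo the print facts Poitou–Tate (`poitouTate_selmerStructure_duality_real`) and Tate's Euler characteristic
(`localEulerPoincareCharacteristic`) only. Proof of (ii): a class of `𝓛_{Wd}` is the Kummer class of a rational `2`-torsion point `T`
(p621907); `𝓛_W = H¹_ur` (X11b, Silverman X.4.4); the transported cocycle at an inertia element `τ₀` with `τ₀ ι(√d) = −ι(√d)` (p621520)
is `θ⁻¹(χ(τ₀)τ₀R − R)` with `R = θ_E(Q)`, `2Q = T`, `4R = 0`, `τ₀R = R` — zero iff `2R = 0` iff `T = 0`.

References: [MazurRubin2010] Remark 2.4, Lemmas 2.2, 2.10, 2.11; [SilvermanAEC2009] VII.4.1, X.4.4, X.5 Cor. 5.4; [MilneADT2006] I §2, Lemma 3.3.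
-/

set_option linter.dupNamespace false -- tree convention: `Summit.BirchSwinnertonDyer.BirchSwinnertonDyer.Theorems` (summit = sub-problem)
set_option autoImplicit false

noncomputable section

open scoped Classical ContRepresentation

namespace Summit.BirchSwinnertonDyer.BirchSwinnertonDyer.Theorems.GenusKolyTwistLocal

open WeierstrassCurve Field NumberField IsDedekindDomain Function
open Literature.NumberTheory.EllipticCurves Literature.NumberTheory.GaloisRepresentations
open Literature.NumberTheory.GaloisRepresentations.IsNonarchimedeanLocalField
open Literature.NumberTheory.GaloisCohomology
open Summit.BirchSwinnertonDyer.Rank1Residual.X11b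
open Summit.BirchSwinnertonDyer.Rank1Residual.X11b.CongruentTransfer

variable {K : Type} [Field K] [NumberField K] (W Wd : WeierstrassCurve K) [W.IsElliptic] [Wd.IsElliptic]

/-! ## §21 One identification: agreement at split places AND transversality at ramified good odd places -/

/-- **Lemma 2.10 (i) and LEMMA 2.11 of Mazur–Rubin for ONE intertwining identification `E^{(d)}[2] ≅ E[2]`** (see the module
docstring). [cite: MazurRubin2010, Remark 2.4, Lemma 2.10 (i), Lemma 2.11] [cite: SilvermanAEC2009, X.4.4, X.5 Cor. 5.4] -/
theorem exists_intertwining_hsplit_and_transverse {d : K} (hd : d ≠ 0) {C : VariableChange K}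
    (hWd : C • W.quadraticTwist d = Wd) :
    ∃ (φ : (Wd.torsionGaloisModule ((2 : ℕ) : ℤ)).toContRepresentation →ⁱL
        (W.torsionGaloisModule ((2 : ℕ) : ℤ)).toContRepresentation)
      (φ' : (W.torsionGaloisModule ((2 : ℕ) : ℤ)).toContRepresentation →ⁱL
        (Wd.torsionGaloisModule ((2 : ℕ) : ℤ)).toContRepresentation),
      (∀ a, φ' (φ a) = a) ∧ (∀ b, φ (φ' b) = b) ∧
      (∀ (E : Type) [Field E] [Algebra K E], (∃ s : E, s ^ 2 = algebraMap K E d) →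
        (Wd.kummerLocalConditionAt ((2 : ℕ) : ℤ) E).map (galoisCohomology.map (φ.restrictField E) 1) =
          W.kummerLocalConditionAt ((2 : ℕ) : ℤ) E) ∧
      ∀ (v : HeightOneSpectrum (𝓞 K)), W.HasGoodReductionAt v → ((2 : ℕ) : 𝓞 K) ∉ v.asIdeal →
        closureEmb (K := K) (v.adicCompletion K) (geomSqrt d) ∉ maxUnramified (v.adicCompletion K) →
        (Wd.kummerLocalConditionAt ((2 : ℕ) : ℤ) (v.adicCompletion K)).map
            (galoisCohomology.map (φ.restrictField (v.adicCompletion K)) 1) ⊓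
          W.kummerLocalConditionAt ((2 : ℕ) : ℤ) (v.adicCompletion K) = ⊥ := by
  haveI : NeZero (2 : K) := ⟨two_ne_zero⟩
  obtain ⟨ψ, hψ, hloc⟩ := exists_addEquiv_geomTorsion_two_localSquare_signed W hd hWd
  have hψ' : ∀ (σ : absoluteGaloisGroup K) (Q : geomTorsion W (2 : ℤ)),
      ψ.symm (σ • Q) = σ • ψ.symm Q := fun σ Q ↦
    ψ.injective (by rw [hψ, ψ.apply_symm_apply, ψ.apply_symm_apply])
  let φ : (Wd.torsionGaloisModule ((2 : ℕ) : ℤ)).toContRepresentation →ⁱL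
      (W.torsionGaloisModule ((2 : ℕ) : ℤ)).toContRepresentation :=
    { toContinuousLinearMap := ⟨ψ.toAddMonoidHom.toIntLinearMap, continuous_of_discreteTopology⟩
      isIntertwining' := fun σ ↦ by
        ext P
        exact congrArg Subtype.val (hψ σ P) }
  let φ' : (W.torsionGaloisModule ((2 : ℕ) : ℤ)).toContRepresentation →ⁱL
      (Wd.torsionGaloisModule ((2 : ℕ) : ℤ)).toContRepresentation :=
    { toContinuousLinearMap := ⟨ψ.symm.toAddMonoidHom.toIntLinearMap, continuous_of_discreteTopology⟩
      isIntertwining' := fun σ ↦ by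
        ext Q
        exact congrArg Subtype.val (hψ' σ Q) }
  have hφ : ∀ a, φ a = ψ a := fun _ ↦ rfl
  have hφ' : ∀ b, φ' b = ψ.symm b := fun _ ↦ rfl
  -- one inclusion of Lemma 2.10 (i), for an arbitrary Γ_E-equivariant intertwined local datum
  have key : ∀ (E : Type) [Field E] [Algebra K E] {X Y : WeierstrassCurve K}
      (χ : (X.torsionGaloisModule ((2 : ℕ) : ℤ)).toContRepresentation →ⁱL
        (Y.torsionGaloisModule ((2 : ℕ) : ℤ)).toContRepresentation) (η : localPoints X E ≃+ localPoints Y E),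
      (∀ (σ : absoluteGaloisGroup E) (Q : localPoints X E), η (σ • Q) = σ • η Q) →
      (∀ t : geomTorsion X ((2 : ℕ) : ℤ),
        pointsMap Y E (χ t : geomPoints Y) = η (pointsMap X E (t : geomPoints X))) →
      ∀ x ∈ X.kummerLocalConditionAt ((2 : ℕ) : ℤ) E,
        galoisCohomology.map (χ.restrictField E) 1 x ∈ Y.kummerLocalConditionAt ((2 : ℕ) : ℤ) E := by
    intro E _ _ X Y χ η hη hχ x hx
    obtain ⟨f, rfl⟩ := oneCocycleClass_surjective
      (DiscreteGaloisModule.toTopRep (GaloisRep.restrictField E (X.torsionGaloisModule ((2 : ℕ) : ℤ)))) x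
    rw [mem_kummerLocalConditionAt_iff, map_torsionPointsMapIntertwining_oneCocycleClass] at hx
    obtain ⟨Q, hQ⟩ := (oneCocycleClass_eq_zero_iff _ _).mp hx
    have hQ' : ∀ σ : absoluteGaloisGroup E,
        pointsMap X E ((f.1 σ : geomTorsion X ((2 : ℕ) : ℤ)) : geomPoints X) = σ • Q - Q := hQ
    rw [galoisCohomology.map_one_oneCocycleClass, mem_kummerLocalConditionAt_iff,
      map_torsionPointsMapIntertwining_oneCocycleClass]
    refine (oneCocycleClass_eq_zero_iff _ _).mpr ⟨η Q, fun σ ↦ ?_⟩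
    change pointsMap Y E ((χ (f.1 σ) : geomTorsion Y ((2 : ℕ) : ℤ)) : geomPoints Y) = σ • η Q - η Q
    rw [hχ, hQ', map_sub, hη]
  refine ⟨φ, φ', fun a ↦ ψ.symm_apply_apply a, fun b ↦ ψ.apply_symm_apply b, fun E _ _ hsq ↦ ?_,
    fun v hv h2v hram ↦ ?_⟩
  · -- (i) split places: every σ fixes ι(√d), θ_E is Γ_E-equivariant
    obtain ⟨s, hs⟩ := hsq
    obtain ⟨θ, hfix, -, -, hsquare⟩ := hloc E
    have hθ : ∀ (σ : absoluteGaloisGroup E) (Q : localPoints Wd E), θ (σ • Q) = σ • θ Q :=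
      fun σ Q ↦ hfix σ (smul_closureEmb_geomSqrt_eq E hs σ) Q
    have hθ' : ∀ (σ : absoluteGaloisGroup E) (Q : localPoints W E), θ.symm (σ • Q) = σ • θ.symm Q :=
      symm_equivariant θ hθ
    have hsquare' : ∀ t : geomTorsion W ((2 : ℕ) : ℤ),
        pointsMap Wd E (ψ.symm t : geomPoints Wd) = θ.symm (pointsMap W E (t : geomPoints W)) := fun t ↦ by
      apply θ.injective
      rw [← hsquare (ψ.symm t), ψ.apply_symm_apply, θ.apply_symm_apply]
    apply le_antisymm
    · rw [AddSubgroup.map_le_iff_le_comap]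
      intro x hx
      exact key E φ θ hθ (fun t ↦ by rw [hφ]; exact hsquare t) x hx
    · intro y hy
      refine ⟨galoisCohomology.map (φ'.restrictField E) 1 y,
        key E φ' θ.symm hθ' (fun t ↦ by rw [hφ']; exact hsquare' t) y hy, ?_⟩
      obtain ⟨f, rfl⟩ := oneCocycleClass_surjective
        (DiscreteGaloisModule.toTopRep (GaloisRep.restrictField E (W.torsionGaloisModule ((2 : ℕ) : ℤ)))) y
      rw [galoisCohomology.map_one_oneCocycleClass, galoisCohomology.map_one_oneCocycleClass]
      congr 1
      apply Subtype.ext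
      ext g : 1
      rw [contOneCocycles.pullback_apply, contOneCocycles.pullback_apply]
      exact ψ.apply_symm_apply (f.1 g)
  · -- (ii) LEMMA 2.11 at a ramified good odd place
    haveI : CharZero (v.adicCompletion K) :=
      Literature.NumberTheory.GaloisRepresentations.charZero_adicCompletion v
    have hn : ((2 : ℕ) : ℤ) ≠ 0 := by norm_num
    obtain ⟨θ, -, hneg, -, hsquare⟩ := hloc (v.adicCompletion K)
    have hx2 : (closureEmb (K := K) (v.adicCompletion K) (geomSqrt d)) ^ 2 =
        algebraMap K (AlgebraicClosure (v.adicCompletion K)) d := by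
      rw [← map_pow, geomSqrt_sq, AlgHom.commutes]
    obtain ⟨τ₀, hτ₀I, hτ₀⟩ := exists_mem_absInertia_smul_eq_neg v hx2 hram
    rw [eq_bot_iff]
    rintro c hc
    obtain ⟨⟨c', hc', rfl⟩, hcW⟩ := AddSubgroup.mem_inf.mp hc
    obtain ⟨T, hT2, rfl⟩ := exists_twoTorsion_localKummerMap_eq W Wd v hd hWd hv h2v hram hc'
    -- `𝓛_W = H¹_ur`
    have hur := KummerPT.kummerSelmerStructure_inr_eq_unramifiedSubgroup W 2 1 h2v hv
    rw [pow_one, kummerSelmerStructure_apply] at hur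
    change W.kummerLocalConditionAt ((2 : ℕ) : ℤ) (v.adicCompletion K) = _ at hur
    rw [hur] at hcW
    -- the local Kummer class of `T` as the class of a cocycle
    set Q := Wd.localZSMulRoot (v.adicCompletion K) hn T with hQdef
    have hQ2 := Wd.zsmul_localZSMulRoot (v.adicCompletion K) hn T
    have hQfix := Wd.zsmul_mem_fixedPoints_of_eq (v.adicCompletion K) hQ2
    have hκ : Wd.localKummerMap (v.adicCompletion K) hn T =
        Wd.localKummerClass ((2 : ℕ) : ℤ) hn Q hQfix := rfl
    rw [hκ, localKummerClass, galoisCohomology.map_one_oneCocycleClass] at hcW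
    have hI : ∀ τ ∈ absInertia (v.adicCompletion K), ∀ w : geomTorsion W ((2 : ℕ) : ℤ),
        GaloisRep.restrictField (v.adicCompletion K) (W.torsionGaloisModule ((2 : ℕ) : ℤ)) τ w = w :=
      fun τ hτ w ↦ AcSelmer.restrictField_torsionGaloisModule_apply_of_mem_absInertia W 2 1 h2v hv hτ w
    have hzero := (LocBridge.mem_unramifiedSubgroup_one_iff_forall_eq_zero _ hI _).mp hcW τ₀ hτ₀I
    -- the cocycle vanishes at `τ₀`: `τ₀ • Q = Q`
    have hcoc : (Wd.localKummerCocycle ((2 : ℕ) : ℤ) hn Q hQfix).1 τ₀ = 0 := by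
      apply ψ.injective
      rw [map_zero]
      exact hzero
    have hτQ : τ₀ • Q = Q := by
      have h := Wd.pointsMap_localKummerCocycle_apply ((2 : ℕ) : ℤ) hn Q hQfix τ₀
      rw [hcoc, ZeroMemClass.coe_zero, map_zero] at h
      exact (sub_eq_zero.mp h.symm).symm ▸ rfl
    -- `R = θ Q` is `4`-torsion, fixed by `τ₀` (inertia), and negated by `τ₀`
    have hR4 : ((2 ^ 2 : ℕ) : ℤ) • θ Q = 0 := by
      rw [← map_zsmul, show ((2 ^ 2 : ℕ) : ℤ) = (2 : ℤ) * ((2 : ℕ) : ℤ) by norm_num, mul_zsmul, hQ2,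
        ← map_zsmul, ← map_zsmul, show ((2 : ℤ)) • T = (2 : ℕ) • T by rw [← natCast_zsmul]; norm_num, hT2,
        map_zero, map_zero, map_zero]
    have hRfix : τ₀ • θ Q = θ Q := smul_eq_self_of_mem_absInertia_of_zsmul_eq_zero W v hv h2v 2 hτ₀I hR4
    have hRneg : θ Q = -(τ₀ • θ Q) := by rw [← hneg τ₀ hτ₀ Q, hτQ]
    rw [hRfix] at hRneg
    have h2R : (2 : ℤ) • θ Q = 0 := by
      rw [two_zsmul]; nth_rewrite 1 [hRneg]; exact neg_add_cancel _
    have h2Q : ((2 : ℕ) : ℤ) • Q = 0 := by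
      apply θ.injective
      rw [map_zsmul, map_zero]
      exact_mod_cast h2R
    have hT0 : T = 0 := by
      rw [hQ2, AddEquiv.map_eq_zero_iff, map_eq_zero_iff _ (toGeomPoints_injective _)] at h2Q
      exact h2Q
    rw [hT0, map_zero, map_zero]
    exact AddSubgroup.zero_mem _

/-! ## §22 Corollary 3.4 (i) DOWN for a quadratic twist, with Lemma 2.10 (i) and Lemma 2.11 DISCHARGED -/

/-- **Mazur–Rubin Corollary 3.4 (i), DOWN direction, for the twist pair `(E, E^{(d)})` at ONE good odd place `v₀` ramified in
`K(√d)`** — the theorem `natCard_selmerGroup_twist_mul_two_eq_of_local` (p620693) with its two displayed local hypotheses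
`hsplit` (Lemma 2.10 (i)) and `htr` (Lemma 2.11) now PROVED (`exists_intertwining_hsplit_and_transverse`): if every finite
`v ≠ v₀` is split in `K(√d)`, or odd and good for both curves, or odd with `E(K_v)[2] = E^{(d)}(K_v)[2] = 0`, every archimedean
place is split or has `H¹ = 0` for both curves, `#E(K_{v₀})[2] = 2`, and some `2`-Selmer class of `E` localises non-trivially at
`v₀`, then `#Sel₂(E^{(d)}/K) · 2 = #Sel₂(E/K)`. CONDITIONAL only on the print facts Poitou–Tate duality for Selmer structures
(`poitouTate_selmerStructure_duality_real`) and Tate's local Euler characteristic (`localEulerPoincareCharacteristic`), both displayed.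
[cite: MazurRubin2010, Prop. 3.3, Cor. 3.4 (i), Lemmas 2.10–2.11] [cite: MilneADT2006, I Thm. 4.10, I Thm. 2.8] -/
theorem natCard_selmerGroup_twist_mul_two_eq {d : K} (hd : d ≠ 0) {C : VariableChange K}
    (hWd : C • W.quadraticTwist d = Wd)
    (hPT : poitouTate_selmerStructure_duality_real K)
    (hEP : ∀ v : HeightOneSpectrum (𝓞 K), localEulerPoincareCharacteristic (v.adicCompletion K))
    (v₀ : HeightOneSpectrum (𝓞 K)) (hv₀ : ((2 : ℕ) : 𝓞 K) ∉ v₀.asIdeal) (hv₀W : W.HasGoodReductionAt v₀)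
    (hram : closureEmb (K := K) (v₀.adicCompletion K) (geomSqrt d) ∉ maxUnramified (v₀.adicCompletion K))
    (hfin : ∀ v : HeightOneSpectrum (𝓞 K), v ≠ v₀ →
      (∃ s : v.adicCompletion K, s ^ 2 = algebraMap K (v.adicCompletion K) d) ∨
      (((2 : ℕ) : 𝓞 K) ∉ v.asIdeal ∧ W.HasGoodReductionAt v ∧ Wd.HasGoodReductionAt v) ∨
      (((2 : ℕ) : 𝓞 K) ∉ v.asIdeal ∧
        Nat.card (nsmulAddMonoidHom 2 : (W.baseChange (v.adicCompletion K)).toAffine.Point →+ _).ker = 1 ∧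
        Nat.card (nsmulAddMonoidHom 2 : (Wd.baseChange (v.adicCompletion K)).toAffine.Point →+ _).ker = 1))
    (hinf : ∀ w : InfinitePlace K,
      (∃ s : w.Completion, s ^ 2 = algebraMap K w.Completion d) ∨
      ((∀ x : galoisCohomology (W.localGaloisModule w.Completion) 1, x = 0) ∧
        (∀ x : galoisCohomology (Wd.localGaloisModule w.Completion) 1, x = 0)))
    (ht : Nat.card (nsmulAddMonoidHom 2 : (W.baseChange (v₀.adicCompletion K)).toAffine.Point →+ _).ker = 2)
    (hns : ∃ c ∈ (W.kummerSelmerStructure ((2 : ℕ) : ℤ)).selmerGroup,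
      galoisCohomology.localization (W.torsionGaloisModule ((2 : ℕ) : ℤ)) (Sum.inr v₀) 1 c ≠ 0) :
    Nat.card (Wd.selmerGroup ((2 : ℕ) : ℤ)) * 2 = Nat.card (W.selmerGroup ((2 : ℕ) : ℤ)) := by
  obtain ⟨φ, φ', hφ'φ, hφφ', hsplit, htr⟩ := exists_intertwining_hsplit_and_transverse W Wd hd hWd
  exact natCard_selmerGroup_twist_mul_two_eq_of_local W Wd d hPT hEP φ φ' hφ'φ hφφ' hsplit v₀ hv₀ hfin hinf
    (htr v₀ hv₀W hv₀ hram) ht hns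

end Summit.BirchSwinnertonDyer.BirchSwinnertonDyer.Theorems.GenusKolyTwistLocal

end
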